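import Summits.CriticalPhenomena.PercolationContinuityZ3.Theorems.Transplant.SkelPhiCorridorKGDepth
import Summits.CriticalPhenomena.PercolationContinuityZ3.Theorems.Transplant.SkelPhiRunQStepsQ
import HarnessLib

/-!
# WAVE-Q binder row «SkelPhiCorridorKGDepth» ↦ «SkelPhiCorridorKGDepthQ» (quasi-step rung (N3-b); WAVE-Q-MANIFEST-rows-v0.5.tsv, 'binder row (script)'):
# **THE DEPTH ROW OF THE CORRIDOR CHAIN FROM THE RUN FRAME'S QUASI-STEPS, UNDER EXACT-FOOTPRINT QUASI-STEPS OF THE CHART** — `Skelφ.coreWindow_nonempty_of_qstepsQ`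

builds on p205010 (kernel theorem, internal audit signed; external expert review pending) — nothing in this file uses p205010; nothing here is a claim about any open node
(the quasi-step node's statement, name and wording are a lead's).  Lane `prim-bschramm`, seat `prim-bschramm-stmt` gen 33 (port pen; pilot family S1, bus 2026-08-27
07:23Z).  Helper file (`--supports stmt-CriticalPhenomena-4575 --as helper`); def-free; ONE theorem, the `Steps ↦ QStepsN M` twin of the tree original
«SkelPhiCorridorKGDepth» `Skelφ.coreWindow_nonempty_of_qsteps` (p5 gen 15): the hunk `(hstep : Steps G φ) ↦ {M : ℕ} (hq : Skelφ.QStepsN G φ M)`, the run frame's quasi-steps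
now of cost `M·(kq+3)` (gen-1 g4's «SkelPhiRunQStepsQ» `qStepsN_runX_of_qStepsN`, p505323, in place of `qStepsN_runX`), hence the ONE radius token of the row
`D₀ + (kq+3)·‖z‖₁ ≤ R ↦ D₀ + M·(kq+3)·‖z‖₁ ≤ R` (manifest §4 FLOORS: radius ×M); every other binder and the proof are byte-identical.  Regression (manifest §2): at `M = 1`
(`Skelφ.qStepsN_of_steps`) the statement is the original's up to `1·(kq+3) = kq+3`.
[cite: KozmaNitzan2024, §4 Lemma 12 (pp. 23–25: nonempty targets)] [cite: MartineauTassion2017, §4.3 (quasi-steps of the frame)]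
-/

noncomputable section

namespace Summit.CriticalPhenomena.PercolationContinuityZ3.Theorems.Transplant

namespace Skelφ

open Literature.Probability.Percolation Literature.Probability.LatticeModels SimpleGraph
open Literature.Barriers.CriticalPhenomena (graphBall graphBall_mono)
open ChainPlanar

variable {V : Type} {G : SimpleGraph V} {φ : V → Site 2}

/-- **THE CORE WINDOWS OF A SCHEDULE READ IN THE x-RUN FRAME ARE NONEMPTY, under exact-footprint quasi-steps of cost `M` of the chart** (depth row `hTne` of the
corridor chain; `Steps ↦ QStepsN M` twin of `coreWindow_nonempty_of_qsteps`, radius row ×M). [cite: KozmaNitzan2024, §4 Lemma 12 (pp. 23–25)] -/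
theorem coreWindow_nonempty_of_qstepsQ {M : ℕ} (hq : QStepsN G φ M) {n : ℕ} (hn : 1 ≤ n) (c₀ : V) (h : ℤ) {σ : ℤ} (hσ : σ = 1 ∨ σ = -1) {kq : ℕ}
    (hκ : h.natAbs ≤ kq * n) (S : ScheduleNP) {Ω : Finset V} {w₀ : V} {R D₀ : ℕ} (hc₀ : c₀ ∈ graphBall G w₀ D₀)
    (hΩball : ∀ u ∈ graphBall G w₀ R, runX φ c₀ n h σ u ∈ S.prism → u ∈ Ω)
    (hR : ∀ z ∈ S.prism, D₀ + M * (kq + 3) * ((z 0).natAbs + (z 1).natAbs) ≤ R) :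
    ∀ k ≤ S.N, (WinIn (runX φ c₀ n h σ) Ω (ScheduleNP.core S (k + 1))).Nonempty := by
  intro k hk
  obtain ⟨z, hz⟩ := S.nonempty (k + 1) (by omega)
  have hzP : z ∈ S.prism := S.sub_prism k hk (S.succ k hk hz)
  obtain ⟨g, hg, hgz⟩ := QStepsN.exists_mem_graphBall_eq (qStepsN_runX_of_qStepsN hq hn c₀ h hσ hκ) c₀ z
  rw [runX_origin] at hg
  simp only [Pi.zero_apply, sub_zero] at hg
  have hgw : g ∈ graphBall G w₀ (D₀ + M * (kq + 3) * ((z 0).natAbs + (z 1).natAbs)) := BoxProdZ2.mem_graphBall_add G hc₀ hg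
  have hgR : g ∈ graphBall G w₀ R := graphBall_mono G _ (hR z hzP) hgw
  refine ⟨g, (mem_WinIn (φ := runX φ c₀ n h σ)).2 ⟨hΩball g hgR (by rw [hgz]; exact hzP), ?_⟩⟩
  rw [hgz]; exact hz

end Skelφ

end Summit.CriticalPhenomena.PercolationContinuityZ3.Theorems.Transplant

end
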